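import Mathlib.LinearAlgebra.Matrix.Rank
import Mathlib.LinearAlgebra.TensorProduct.Matrix
import Mathlib.LinearAlgebra.Dimension.Constructions
import Mathlib.RingTheory.TensorProduct.Finite
import Mathlib.Data.Complex.Basic
import Literature.Computability.AlgebraicComplexity.KroneckerRank

/-!
# ProbeRankScaling / AggregationSaturation — toolkit for probe-rank-bounded decompositions

Helper lemmas for the support item `AggregationSaturation` (stmt-MatrixMultiplication-7540) of
route `ProbeRankScaling`: a *probe-rank-`ρ` decomposition* of `⟨n,n,n⟩` with `r` terms is
`⟨n,n,n⟩ = ∑_{l<r} w_l ⊗ u_l ⊗ v_l` (tree: `matMulTensor`, `triad`) whose probes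
`w_l, u_l, v_l ∈ ℂ^{n×n}`, read as matrices `Matrix.of (Function.curry ·)`, all have rank `≤ ρ`.
This file proves the closure properties of that filtration used by the saturation argument:

* `rank_kronecker_le` — `rank (A ⊗ₖ B) ≤ rank A · rank B` (via `TensorProduct.map`);
* `exists_decomp_of_equiv` — transport of a decomposition of the abstract matrix multiplication
  tensor on an index type `α ≃ Fin N`, with terms indexed by any finite type, to the tree's
  `matMulTensor ℂ N N N` with terms indexed by `Fin r` (probe ranks are preserved);
* `exists_decomp_mul` — KRONECKER CLOSURE: decompositions of `⟨m⟩` (probe ranks `≤ ρ₀`, `r₀`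
  terms) and `⟨q⟩` (`≤ ρ₁`, `r₁` terms) give one of `⟨mq⟩` with `r₀r₁` terms and probe ranks
  `≤ ρ₀ρ₁` (`kroneckerTensor_matMulTensor` + `rank_kronecker_le`);
* `exists_decomp_of_le` — ZERO-PADDING / RESTRICTION: a decomposition of `⟨n'⟩` restricts along
  `Fin n ↪ Fin n'` (`n ≤ n'`) to one of `⟨n⟩` with the same number of terms and no larger probe
  ranks (`Matrix.rank_submatrix_le`);
* `exists_decomp_schoolbook` — the standard algorithm: `n³` terms, all probe ranks `≤ 1`.

References: M. Bläser, *Fast Matrix Multiplication*, Theory of Computing Graduate Surveys 5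
(2013), §5.2 (Kronecker products of matrix tensors), §4 (the standard algorithm).
-/

-- `Summit.<Summit>.<Problem>` is the tree's mandated summit-side namespace; for this
-- single-conjunct summit the two coincide, so the file silences `dupNamespace`.
set_option linter.dupNamespace false

noncomputable section

open scoped BigOperators Kronecker TensorProduct
open Function Matrix

namespace Summit.MatrixMultiplication.MatrixMultiplication.Theorems

namespace ProbeRankScalingAggregationSaturation

open Literature.Computability.AlgebraicComplexity

/-- `rank (A ⊗ₖ B) ≤ rank A · rank B` over a field: under `Matrix.toLin` the Kronecker product is
`TensorProduct.map f g`, whose range is the image of `range f ⊗ range g`. [folklore] -/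
theorem rank_kronecker_le {K : Type*} [Field K] {m n p q : Type*} [Fintype m] [Fintype n]
    [Fintype p] [Fintype q] [DecidableEq m] [DecidableEq n] [DecidableEq p] [DecidableEq q]
    (A : Matrix m n K) (B : Matrix p q K) :
    (A ⊗ₖ B).rank ≤ A.rank * B.rank := by
  let bn := Pi.basisFun K n
  let bm := Pi.basisFun K m
  let bq := Pi.basisFun K q
  let bp := Pi.basisFun K p
  rw [Matrix.rank_eq_finrank_range_toLin (A ⊗ₖ B) (bm.tensorProduct bp) (bn.tensorProduct bq),
    Matrix.toLin_kronecker, Matrix.rank_eq_finrank_range_toLin A bm bn,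
    Matrix.rank_eq_finrank_range_toLin B bp bq]
  set f := Matrix.toLin bn bm A
  set g := Matrix.toLin bq bp B
  have h1 : LinearMap.range (TensorProduct.map f g) =
      LinearMap.range (TensorProduct.mapIncl (LinearMap.range f) (LinearMap.range g)) := by
    rw [TensorProduct.range_map, TensorProduct.range_mapIncl]
  rw [h1]
  calc Module.finrank K (LinearMap.range (TensorProduct.mapIncl _ _))
      ≤ Module.finrank K ((LinearMap.range f) ⊗[K] (LinearMap.range g)) :=
        LinearMap.finrank_range_le _
    _ = _ := Module.finrank_tensorProduct

/-- Entries of a finite sum of triads indexed by an arbitrary finite type. [folklore] -/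
theorem sum_triad_apply' {σ ι κ μ : Type*} [Fintype σ] (w : σ → ι → ℂ) (u : σ → κ → ℂ)
    (v : σ → μ → ℂ) (a : ι) (b : κ) (c : μ) :
    (∑ s, triad (w s) (u s) (v s)) a b c = ∑ s, w s a * u s b * v s c := by
  rw [Finset.sum_apply, Finset.sum_apply, Finset.sum_apply]
  simp only [triad_apply]

/-- TRANSPORT. A decomposition of the abstract matrix multiplication tensor on a finite index
type `α` (entry `1` at `((κ,ν),(κ,μ),(μ,ν))`, `0` elsewhere), with terms indexed by a finite type
`σ` of cardinality `r` and all probe ranks `≤ ρ`, yields — along any bijection `α ≃ Fin N` — a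
decomposition of `matMulTensor ℂ N N N` into `r` triads indexed by `Fin r` with all probe ranks
`≤ ρ`. [folklore] -/
theorem exists_decomp_of_equiv {α σ : Type*} [Fintype α] [DecidableEq α] [Fintype σ]
    {N r ρ : ℕ} (e : α ≃ Fin N) (hσ : Fintype.card σ = r)
    (W U V : σ → α × α → ℂ)
    (hdec : (fun a b c : α × α => if a.1 = b.1 ∧ b.2 = c.1 ∧ a.2 = c.2 then (1 : ℂ) else 0) =
      ∑ s, triad (W s) (U s) (V s))
    (hrank : ∀ s, (Matrix.of (curry (W s))).rank ≤ ρ ∧ (Matrix.of (curry (U s))).rank ≤ ρ ∧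
      (Matrix.of (curry (V s))).rank ≤ ρ) :
    ∃ (w u v : Fin r → Fin N × Fin N → ℂ),
      matMulTensor ℂ N N N = ∑ l, triad (w l) (u l) (v l) ∧
      ∀ l, (Matrix.of (curry (w l))).rank ≤ ρ ∧ (Matrix.of (curry (u l))).rank ≤ ρ ∧
        (Matrix.of (curry (v l))).rank ≤ ρ := by
  classical
  -- term reindexing `Fin r ≃ σ` and coordinate pull-back along `e.symm × e.symm`
  let ι : Fin r ≃ σ := (Fintype.equivFinOfCardEq hσ).symm
  let pb : (α × α → ℂ) → (Fin N × Fin N → ℂ) := fun f x => f (e.symm x.1, e.symm x.2)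
  have hpb : ∀ f : α × α → ℂ, (Matrix.of (curry (pb f))).rank ≤ (Matrix.of (curry f)).rank := by
    intro f
    have : Matrix.of (curry (pb f)) = (Matrix.of (curry f)).submatrix e.symm e.symm := by
      ext i j; rfl
    rw [this, Matrix.rank_submatrix]
  refine ⟨fun l => pb (W (ι l)), fun l => pb (U (ι l)), fun l => pb (V (ι l)), ?_, fun l =>
    ⟨(hpb _).trans (hrank _).1, (hpb _).trans (hrank _).2.1, (hpb _).trans (hrank _).2.2⟩⟩
  funext x y z
  rw [sum_triad_apply]
  have h := congrFun (congrFun (congrFun hdec (e.symm x.1, e.symm x.2)) (e.symm y.1, e.symm y.2))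
    (e.symm z.1, e.symm z.2)
  simp only [sum_triad_apply', EmbeddingLike.apply_eq_iff_eq] at h
  have hL : matMulTensor ℂ N N N x y z =
      if x.1 = y.1 ∧ y.2 = z.1 ∧ x.2 = z.2 then (1 : ℂ) else 0 := rfl
  rw [hL, h]
  exact (Fintype.sum_equiv ι _ _ fun l => rfl).symm

/-- KRONECKER CLOSURE of the probe-rank filtration (Bläser 2013, §5.2: `⟨m⟩ ⊗ ⟨q⟩ ≅ ⟨mq⟩`):
decompositions of `⟨m,m,m⟩` with `r₀` terms and probe ranks `≤ ρ₀` and of `⟨q,q,q⟩` with `r₁`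
terms and probe ranks `≤ ρ₁` give a decomposition of `⟨mq,mq,mq⟩` with `r₀·r₁` terms whose
probes — Kronecker products of the factors' probes — have rank `≤ ρ₀·ρ₁`.
[cite: Blaser2013, §5.2 p. 24] -/
theorem exists_decomp_mul {m q r₀ r₁ ρ₀ ρ₁ : ℕ}
    {w u v : Fin r₀ → Fin m × Fin m → ℂ} {w₁ u₁ v₁ : Fin r₁ → Fin q × Fin q → ℂ}
    (h₀ : matMulTensor ℂ m m m = ∑ l, triad (w l) (u l) (v l))
    (h₁ : matMulTensor ℂ q q q = ∑ l, triad (w₁ l) (u₁ l) (v₁ l))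
    (hr₀ : ∀ l, (Matrix.of (curry (w l))).rank ≤ ρ₀ ∧ (Matrix.of (curry (u l))).rank ≤ ρ₀ ∧
      (Matrix.of (curry (v l))).rank ≤ ρ₀)
    (hr₁ : ∀ l, (Matrix.of (curry (w₁ l))).rank ≤ ρ₁ ∧ (Matrix.of (curry (u₁ l))).rank ≤ ρ₁ ∧
      (Matrix.of (curry (v₁ l))).rank ≤ ρ₁) :
    ∃ (w' u' v' : Fin (r₀ * r₁) → Fin (m * q) × Fin (m * q) → ℂ),
      matMulTensor ℂ (m * q) (m * q) (m * q) = ∑ l, triad (w' l) (u' l) (v' l) ∧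
      ∀ l, (Matrix.of (curry (w' l))).rank ≤ ρ₀ * ρ₁ ∧
        (Matrix.of (curry (u' l))).rank ≤ ρ₀ * ρ₁ ∧ (Matrix.of (curry (v' l))).rank ≤ ρ₀ * ρ₁ := by
  classical
  let e := doubleIndexEquiv m m q q
  -- Kronecker product of two probes, read on `Fin (mq) × Fin (mq)`
  let kp : (Fin m × Fin m → ℂ) → (Fin q × Fin q → ℂ) → (Fin (m * q) × Fin (m * q) → ℂ) :=
    fun f g x => f (e.symm x).1 * g (e.symm x).2
  have hkp : ∀ (f : Fin m × Fin m → ℂ) (g : Fin q × Fin q → ℂ),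
      (Matrix.of (curry (kp f g))).rank ≤
        (Matrix.of (curry f)).rank * (Matrix.of (curry g)).rank := by
    intro f g
    have : Matrix.of (curry (kp f g)) =
        ((Matrix.of (curry f)) ⊗ₖ (Matrix.of (curry g))).submatrix finProdFinEquiv.symm
          finProdFinEquiv.symm := by
      ext i j; rfl
    rw [this, Matrix.rank_submatrix]
    exact rank_kronecker_le _ _
  let ι : Fin (r₀ * r₁) ≃ Fin r₀ × Fin r₁ := finProdFinEquiv.symm
  refine ⟨fun l => kp (w (ι l).1) (w₁ (ι l).2), fun l => kp (u (ι l).1) (u₁ (ι l).2),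
    fun l => kp (v (ι l).1) (v₁ (ι l).2), ?_, fun l => ⟨?_, ?_, ?_⟩⟩
  · funext x y z
    obtain ⟨X, rfl⟩ := e.surjective x
    obtain ⟨Y, rfl⟩ := e.surjective y
    obtain ⟨Z, rfl⟩ := e.surjective z
    rw [← kroneckerTensor_matMulTensor, kroneckerTensor_apply, sum_triad_apply]
    simp only [kp, e, Equiv.symm_apply_apply]
    rw [h₀, h₁, sum_triad_apply, sum_triad_apply, Finset.sum_mul_sum, ← Fintype.sum_prod_type']
    refine Fintype.sum_equiv ι.symm _ _ (fun p => ?_)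
    simp only [ι, Equiv.symm_symm, Equiv.symm_apply_apply]
    ring
  · exact (hkp _ _).trans (Nat.mul_le_mul (hr₀ _).1 (hr₁ _).1)
  · exact (hkp _ _).trans (Nat.mul_le_mul (hr₀ _).2.1 (hr₁ _).2.1)
  · exact (hkp _ _).trans (Nat.mul_le_mul (hr₀ _).2.2 (hr₁ _).2.2)

/-- RESTRICTION (zero-padding read backwards): a decomposition of `⟨n',n',n'⟩` restricts along
the order embedding `Fin n ↪ Fin n'` (`n ≤ n'`) to a decomposition of `⟨n,n,n⟩` with the same
number of terms; the probes become submatrices, so probe ranks do not increase. [folklore] -/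
theorem exists_decomp_of_le {n n' r ρ : ℕ} (hn : n ≤ n')
    {w u v : Fin r → Fin n' × Fin n' → ℂ}
    (h : matMulTensor ℂ n' n' n' = ∑ l, triad (w l) (u l) (v l))
    (hr : ∀ l, (Matrix.of (curry (w l))).rank ≤ ρ ∧ (Matrix.of (curry (u l))).rank ≤ ρ ∧
      (Matrix.of (curry (v l))).rank ≤ ρ) :
    ∃ (w' u' v' : Fin r → Fin n × Fin n → ℂ),
      matMulTensor ℂ n n n = ∑ l, triad (w' l) (u' l) (v' l) ∧
      ∀ l, (Matrix.of (curry (w' l))).rank ≤ ρ ∧ (Matrix.of (curry (u' l))).rank ≤ ρ ∧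
        (Matrix.of (curry (v' l))).rank ≤ ρ := by
  classical
  let ι : Fin n → Fin n' := Fin.castLE hn
  have hι : Function.Injective ι := Fin.castLE_injective hn
  let pb : (Fin n' × Fin n' → ℂ) → (Fin n × Fin n → ℂ) := fun f x => f (ι x.1, ι x.2)
  have hpb : ∀ f : Fin n' × Fin n' → ℂ,
      (Matrix.of (curry (pb f))).rank ≤ (Matrix.of (curry f)).rank := by
    intro f
    have : Matrix.of (curry (pb f)) = (Matrix.of (curry f)).submatrix ι ι := by
      ext i j; rfl
    rw [this]
    exact Matrix.rank_submatrix_le _ _ _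
  refine ⟨fun l => pb (w l), fun l => pb (u l), fun l => pb (v l), ?_, fun l =>
    ⟨(hpb _).trans (hr _).1, (hpb _).trans (hr _).2.1, (hpb _).trans (hr _).2.2⟩⟩
  funext x y z
  have hx := congrFun (congrFun (congrFun h (ι x.1, ι x.2)) (ι y.1, ι y.2)) (ι z.1, ι z.2)
  rw [sum_triad_apply] at hx
  rw [sum_triad_apply]
  simp only [pb]
  rw [← hx]
  simp only [matMulTensor, hι.eq_iff]

/-- The STANDARD ALGORITHM as a probe-rank-`1` decomposition: `⟨n,n,n⟩ = ∑_{κ,μ,ν} e_{κν} ⊗ e_{κμ}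
⊗ e_{μν}` has `n³` terms and all probes are single-entry matrices (rank `≤ 1`).
[cite: Blaser2013, §5] -/
theorem exists_decomp_schoolbook (n : ℕ) :
    ∃ (w u v : Fin (n ^ 3) → Fin n × Fin n → ℂ),
      matMulTensor ℂ n n n = ∑ l, triad (w l) (u l) (v l) ∧
      ∀ l, (Matrix.of (curry (w l))).rank ≤ 1 ∧ (Matrix.of (curry (u l))).rank ≤ 1 ∧
        (Matrix.of (curry (v l))).rank ≤ 1 := by
  classical
  -- probes `x ↦ [x.1 = i] [x.2 = j]`, of rank ≤ 1
  let sg : Fin n → Fin n → (Fin n × Fin n → ℂ) := fun i j x =>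
    (if x.1 = i then 1 else 0) * (if x.2 = j then 1 else 0)
  have hsg : ∀ i j, (Matrix.of (curry (sg i j))).rank ≤ 1 := by
    intro i j
    have : Matrix.of (curry (sg i j)) =
        vecMulVec (fun a => if a = i then (1 : ℂ) else 0) (fun b => if b = j then 1 else 0) := by
      ext a b; rfl
    rw [this]
    exact Matrix.rank_vecMulVec_le _ _
  have hcard : Fintype.card (Fin n × Fin n × Fin n) = n ^ 3 := by
    simp [Fintype.card_prod]; ring
  refine exists_decomp_of_equiv (Equiv.refl (Fin n)) hcard
    (fun p => sg p.1 p.2.2) (fun p => sg p.1 p.2.1) (fun p => sg p.2.1 p.2.2) ?_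
    (fun p => ⟨hsg _ _, hsg _ _, hsg _ _⟩)
  funext a b c
  rw [sum_triad_apply']
  obtain ⟨a₁, a₂⟩ := a
  obtain ⟨b₁, b₂⟩ := b
  obtain ⟨c₁, c₂⟩ := c
  simp only [sg, Fintype.sum_prod_type]
  simp only [mul_comm, mul_ite, mul_one, mul_zero]
  by_cases h₁ : a₁ = b₁ <;> by_cases h₂ : b₂ = c₁ <;> by_cases h₃ : a₂ = c₂ <;>
    simp [h₁, h₂, h₃]

end ProbeRankScalingAggregationSaturation

end Summit.MatrixMultiplication.MatrixMultiplication.Theorems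

end
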